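import Summits.BirchSwinnertonDyer.Rank1Residual.AdditivePotMult.PrimeToPDescent
import HarnessLib

/-!
# Prime-to-`p` descent for `H¹`: `res : H¹(B, M) ⥲ H¹(A, M)^{B/A}` for a `p`-primary module `M` and
# `A ≤ B` of finite index prime to `p` (cell `b2b-bsdres`, team n1011, row T-RD-Δ-K = the KERNEL half
# of r2's ROUTE-2 §II.15.3 ARM δ; lead R5-40 (b); seat n1011-p05 gen 3)

HONEST FRAMING (cell `b2b-bsdres`, run/shared/lean/b2b/bsd-rank1-residual/, verbatim in every
file): the goal of the cell is to DELETE the COMBINATION-SHAPED residual classes of the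
Birch–Swinnerton-Dyer formula for ALL analytic-rank `≤ 1` elliptic curves over `ℚ` — "full BSD
formula for every rank `≤ 1` curve in class `C`" assembled STRICTLY from published theorems — so
that the rank-`≤ 1` remainder becomes exactly the CONSTRUCTION-SHAPED classes, which are TYPED
(missing-input `Prop`s), NOT attempted. This is not "finishing BSD". Team n1011 (X4 ∧ `p = 3`,
§I N10/N11; ROUTE-2 of planner r2): research route; TOOL theorems of group / Galois cohomology
only; no definition, no named fact; nothing booked; no label changes.

## What and why

r2's ARM δ (ROUTE-2 §II.15.3) moves every local-at-`p` ingredient of the tame potentially-ordinary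
additive rows to the tame field `K ⊂ ℚ(μ_p)` (degree `e ∣ p − 1`, prime to `p`) over which the curve
is good ordinary, and DESCENDS along `Δ = Gal(K/ℚ)`: "for every `p`-primary `G`-module `M`,
`res : H¹(ℚ_{∞,w}, M) ⥲ H¹(K_{∞,w'}, M)^{Δ_w}` (Hochschild–Serre, `H^i(Δ_w, ·) = 0` as `#Δ_w` is
prime to `p`)".  In the tree's model of `H¹` of a subgroup of a topological group acting on a
discrete module (`subgroupH1 B M`, `resOfLe`, `conjH1`; files `SubgroupSelmer`,
`SelmerRestrictionCorank(Relative)`, `PeriodIndexCorestriction`) this is, WITHOUT any cohomology of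
the quotient group, the combination of sub-cell additive-p1's `PrimeToPDescent` §0–§1 (kernel of
`res_{B→A}` killed by `[B : A]`; `[B : A] • H¹(A, M)^B ⊆ res H¹(B, M)`; `× n` bijective on a
`p`-primary group for `p ∤ n`) — used BY NAME:

* `mem_ker_of_nsmul_mem_ker_of_coprime` — kernels of homomorphisms out of a `p`-primary group are
  `n`-saturated for `p ∤ n`;
* `resOfLe_injective_of_coprime` — **`res : H¹(B, M) → H¹(A, M)` is injective** (`A ≤ B`, `A` open
  in `B`, `[B : A]` finite and prime to `p`, `H¹(B, M)` `p`-primary);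
* `exists_unique_resOfLe_eq_of_forall_conjH1_eq_of_coprime` — **every `B`-invariant class of
  `H¹(A, M)` is the restriction of a unique class** (`A` normal, `H¹(A, M)` `p`-primary): together,
  **`res : H¹(B, M) ⥲ H¹(A, M)^{B/A}`**;
* `…_of_isClosed` variants: `p`-primarity of `H¹(·, M)` from `M` `p`-primary and the subgroup closed
  in a compact `G` (tree `exists_pow_nsmul_eq_zero_subgroupH1`);
* §3 `exists_invariant_lift_of_coprime` — **`Δ`-invariants are exact on `p`-primary `Δ`-modules**
  for a finite group `Δ` of order prime to `p` (every invariant of a quotient lifts to an invariant: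
  average and divide by `#Δ`), r2's "Δ-invariants exact" in module form.

The global Selmer descent `Sel_{p^∞}(E/L') ⥲ Sel_{p^∞}(E/L)^{Gal(L/L')}` is additive-p1's
`selmerRelRestriction_bijective_of_coprime` (NOT re-proved); the local 'Greenberg ⊆ Kummer' descent
is the sibling `Additive/GreenbergKummerTameDescent.lean`.

References: [SerreGaloisCohomology1997] I.§2.4 (res/cor); [GreenbergLNM1716] §5 p. 143 (the display
`H¹(ℚ_Σ/ℚ_∞, C) ≅ H¹(ℚ_Σ/F_∞, C)^Δ`); [DokchitserDokchitserAnnals2010] Lemma 4.14 (mechanism).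
-/

noncomputable section

open scoped Classical

universe u

namespace Summit.BirchSwinnertonDyer.Rank1Residual.GaloisImage

open Literature.NumberTheory.EllipticCurves Literature.NumberTheory.GaloisRepresentations
  Summit.BirchSwinnertonDyer.Rank1Residual.AdditivePotMult

/-! ## §1 Kernels out of a `p`-primary group are `n`-saturated (`p ∤ n`) -/

section Algebra

variable {X Y : Type*} [AddCommGroup X] [AddCommGroup Y] {p : ℕ}

/-- In a `p`-primary abelian group, `n • x ∈ ker f` with `p ∤ n` forces `x ∈ ker f` (`f x` is
killed by `n` and by a power of `p`). [folklore] -/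
theorem mem_ker_of_nsmul_mem_ker_of_coprime (f : X →+ Y) (hX : ∀ x : X, ∃ k : ℕ, p ^ k • x = 0)
    {n : ℕ} (hn : n.Coprime p) {x : X} (h : n • x ∈ f.ker) : x ∈ f.ker := by
  rw [AddMonoidHom.mem_ker] at h ⊢
  rw [map_nsmul] at h
  -- `f x` lies in the `p`-primary image of `X`
  obtain ⟨k, hk⟩ := hX x
  have hpk : p ^ k • f x = 0 := by rw [← map_nsmul, hk, map_zero]
  -- Bézout on the element `f x`
  have hd1 : addOrderOf (f x) ∣ n := addOrderOf_dvd_iff_nsmul_eq_zero.mpr h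
  have hd2 : addOrderOf (f x) ∣ p ^ k := addOrderOf_dvd_iff_nsmul_eq_zero.mpr hpk
  have hcop : Nat.Coprime n (p ^ k) := Nat.Coprime.pow_right k hn
  have hd : addOrderOf (f x) ∣ 1 := hcop ▸ Nat.dvd_gcd hd1 hd2
  exact AddMonoid.addOrderOf_eq_one_iff.mp (Nat.dvd_one.mp hd)

end Algebra

/-! ## §2 `res : H¹(B, M) ⥲ H¹(A, M)^{B/A}` for `[B : A]` prime to `p` -/

section Descent

variable {G : Type u} [Group G] [TopologicalSpace G] [IsTopologicalGroup G]
variable {A B : Subgroup G}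
variable (M : Type u) [AddCommGroup M] [DistribMulAction G M] [TopologicalSpace M]
  [DiscreteTopology M]
variable {p : ℕ} [Fact p.Prime]

omit [Fact p.Prime] in
/-- **`res : H¹(B, M) → H¹(A, M)` is INJECTIVE when `[B : A]` is prime to `p` and `H¹(B, M)` is
`p`-primary** (`A ≤ B` of finite index, open in `B`): the kernel is killed by `[B : A]`
(`cor ∘ res`, additive-p1 `relIndex_nsmul_eq_zero_of_resOfLe_eq_zero_rel`) and by a power of `p`.
[cite: SerreGaloisCohomology1997, I.§2.4] -/
theorem resOfLe_injective_of_coprime (h : A ≤ B) (hAB : IsOpen (A.subgroupOf B : Set B))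
    [(A.subgroupOf B).FiniteIndex] (hB : ∀ x : subgroupH1 B M, ∃ k : ℕ, p ^ k • x = 0)
    (hcop : (A.relIndex B).Coprime p) :
    Function.Injective (resOfLe M h : subgroupH1 B M → subgroupH1 A M) := by
  intro x y hxy
  have h0 : resOfLe M h (x - y) = 0 := by rw [map_sub, hxy, sub_self]
  have h1 := relIndex_nsmul_eq_zero_of_resOfLe_eq_zero_rel M h hAB h0
  exact sub_eq_zero.mp (eq_zero_of_nsmul_eq_zero_of_coprime hB hcop h1)

variable [A.Normal]

/-- **Every `B`-invariant class of `H¹(A, M)` is the restriction of a UNIQUE class of `H¹(B, M)`**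
when `[B : A]` is prime to `p` and `H¹(A, M)`, `H¹(B, M)` are `p`-primary (`A` normal, open in `B`, of
finite index): `[B : A] • H¹(A, M)^B ⊆ res H¹(B, M)` (`res ∘ cor`, additive-p1
`exists_resOfLe_eq_relIndex_nsmul_rel`) and `× [B : A]` is a bijection of `H¹(A, M)` preserving
`B`-invariance. With `resOfLe_injective_of_coprime`: `res : H¹(B, M) ⥲ H¹(A, M)^{B/A}` — the
prime-to-`p` Hochschild–Serre descent without cohomology of `B/A`.
[cite: GreenbergLNM1716, §5 p. 143] [cite: DokchitserDokchitserAnnals2010, Lemma 4.14 (proof)] -/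
theorem exists_unique_resOfLe_eq_of_forall_conjH1_eq_of_coprime (h : A ≤ B)
    (hAB : IsOpen (A.subgroupOf B : Set B)) [(A.subgroupOf B).FiniteIndex]
    (hA : ∀ y : subgroupH1 A M, ∃ k : ℕ, p ^ k • y = 0)
    (hB : ∀ x : subgroupH1 B M, ∃ k : ℕ, p ^ k • x = 0) (hcop : (A.relIndex B).Coprime p)
    {y : subgroupH1 A M} (hy : ∀ g : B, conjH1 A M (g : G) y = y) :
    ∃! x : subgroupH1 B M, resOfLe M h x = y := by
  -- `y = [B:A] • y₀` with `y₀` invariant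
  obtain ⟨y₀, hy₀⟩ := exists_nsmul_eq_of_coprime hA hcop y
  have hy₀inv : ∀ g : B, conjH1 A M (g : G) y₀ = y₀ := by
    intro g
    apply (nsmul_bijective_of_coprime hA hcop).1
    change A.relIndex B • conjH1 A M (g : G) y₀ = A.relIndex B • y₀
    rw [← map_nsmul, hy₀, hy g]
  obtain ⟨x, hx⟩ := exists_resOfLe_eq_relIndex_nsmul_rel M h hAB hy₀inv
  refine ⟨x, ?_, fun x' hx' => ?_⟩
  · change resOfLe M h x = y
    rw [hx, hy₀]
  · change resOfLe M h x' = y at hx'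
    exact resOfLe_injective_of_coprime M h hAB hB hcop (by rw [hx', hx, hy₀])

omit [Fact p.Prime] in
/-- Restricted classes are `B`-invariant (tree `conjH1_resOfLe_of_mem`). [folklore] -/
theorem conjH1_resOfLe_eq [B.Normal] (h : A ≤ B) (g : B) (x : subgroupH1 B M) :
    conjH1 A M (g : G) (resOfLe M h x) = resOfLe M h x :=
  conjH1_resOfLe_of_mem M h g.2 x

/-- **`res : H¹(B, M) ⥲ H¹(A, M)^{B/A}` as a bijection onto the invariant classes.**
[cite: GreenbergLNM1716, §5 p. 143] -/
theorem resOfLe_bijective_invariants_of_coprime [B.Normal] (h : A ≤ B)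
    (hAB : IsOpen (A.subgroupOf B : Set B)) [(A.subgroupOf B).FiniteIndex]
    (hA : ∀ y : subgroupH1 A M, ∃ k : ℕ, p ^ k • y = 0)
    (hB : ∀ x : subgroupH1 B M, ∃ k : ℕ, p ^ k • x = 0) (hcop : (A.relIndex B).Coprime p) :
    Function.Bijective (fun x : subgroupH1 B M =>
      (⟨resOfLe M h x, fun g => conjH1_resOfLe_eq M h g x⟩ :
        {y : subgroupH1 A M // ∀ g : B, conjH1 A M (g : G) y = y})) := by
  refine ⟨fun x x' hxx' => resOfLe_injective_of_coprime M h hAB hB hcop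
      (congrArg Subtype.val hxx'), fun y => ?_⟩
  obtain ⟨x, hx, -⟩ := exists_unique_resOfLe_eq_of_forall_conjH1_eq_of_coprime M h hAB hA hB hcop y.2
  exact ⟨x, Subtype.ext hx⟩

/-! ### `p`-primarity of `H¹` from a compact group and a `p`-primary module -/

omit [A.Normal] [Fact p.Prime] in
/-- For `G` compact, `B` closed and `M` `p`-primary, `H¹(B, M)` is `p`-primary (tree
`exists_pow_nsmul_eq_zero_subgroupH1`) — the standing situation of Galois cohomology.
[cite: GreenbergLNM1716, §2] -/
theorem resOfLe_injective_of_coprime_of_isClosed [CompactSpace G] (h : A ≤ B)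
    (hAB : IsOpen (A.subgroupOf B : Set B)) [(A.subgroupOf B).FiniteIndex]
    (hBc : IsClosed (B : Set G)) (hM : ∀ m : M, ∃ k : ℕ, p ^ k • m = 0)
    (hcop : (A.relIndex B).Coprime p) :
    Function.Injective (resOfLe M h : subgroupH1 B M → subgroupH1 A M) :=
  resOfLe_injective_of_coprime M h hAB (exists_pow_nsmul_eq_zero_subgroupH1 B hBc hM) hcop

/-- Compact/closed form of the descent: `res : H¹(B, M) ⥲ H¹(A, M)^{B/A}` for `A ≤ B` closed in a
compact `G`, `A` normal and open in `B`, `[B : A]` prime to `p`, `M` `p`-primary.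
[cite: GreenbergLNM1716, §5 p. 143] -/
theorem exists_unique_resOfLe_eq_of_forall_conjH1_eq_of_coprime_of_isClosed [CompactSpace G]
    (h : A ≤ B) (hAB : IsOpen (A.subgroupOf B : Set B)) [(A.subgroupOf B).FiniteIndex]
    (hAc : IsClosed (A : Set G)) (hBc : IsClosed (B : Set G))
    (hM : ∀ m : M, ∃ k : ℕ, p ^ k • m = 0) (hcop : (A.relIndex B).Coprime p)
    {y : subgroupH1 A M} (hy : ∀ g : B, conjH1 A M (g : G) y = y) :
    ∃! x : subgroupH1 B M, resOfLe M h x = y :=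
  exists_unique_resOfLe_eq_of_forall_conjH1_eq_of_coprime M h hAB
    (exists_pow_nsmul_eq_zero_subgroupH1 A hAc hM) (exists_pow_nsmul_eq_zero_subgroupH1 B hBc hM)
    hcop hy

end Descent

/-! ## §3 `Δ`-invariants are exact on `p`-primary `Δ`-modules, `#Δ` prime to `p` -/

section Invariants

variable {Δ : Type*} [Group Δ] [Fintype Δ] {X Y : Type*} [AddCommGroup X] [AddCommGroup Y]
  [DistribMulAction Δ X] [DistribMulAction Δ Y] {p : ℕ} [Fact p.Prime]

omit [Fact p.Prime] in
/-- The norm `∑_δ δ • m` is `Δ`-invariant. [folklore] -/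
theorem smul_sum_smul_eq (m : X) (g : Δ) : g • (∑ δ : Δ, δ • m) = ∑ δ : Δ, δ • m := by
  rw [Finset.smul_sum]
  simp_rw [smul_smul]
  exact Fintype.sum_bijective (g * ·) (Group.mulLeft_bijective g) _ _ (fun _ => rfl)

/-- **`Δ`-invariants are exact on `p`-primary `Δ`-modules when `#Δ` is prime to `p`** (the
surjectivity half; left exactness is automatic): for an equivariant surjection `f : X → Y` of
`p`-primary `Δ`-modules every `Δ`-invariant of `Y` lifts to a `Δ`-invariant of `X` — average a lift
and divide by `#Δ` (r2 ROUTE-2 §II.15.3: "`Δ`-invariants exact; invariants = coinvariants").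
[cite: SerreGaloisCohomology1997, I.§2.4] -/
theorem exists_invariant_lift_of_coprime (f : X →+ Y) (hf : ∀ (g : Δ) (m : X), f (g • m) = g • f m)
    (hsurj : Function.Surjective f) (hX : ∀ m : X, ∃ k : ℕ, p ^ k • m = 0)
    (hY : ∀ n : Y, ∃ k : ℕ, p ^ k • n = 0) (hcop : (Fintype.card Δ).Coprime p)
    {n : Y} (hn : ∀ g : Δ, g • n = n) : ∃ m : X, (∀ g : Δ, g • m = m) ∧ f m = n := by
  obtain ⟨m₀, hm₀⟩ := hsurj n
  set s : X := ∑ δ : Δ, δ • m₀ with hs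
  have hsinv : ∀ g : Δ, g • s = s := fun g => smul_sum_smul_eq m₀ g
  have hfs : f s = Fintype.card Δ • n := by
    rw [hs, map_sum]
    simp_rw [hf, hm₀, hn]
    rw [Finset.sum_const, Finset.card_univ]
  obtain ⟨m, hm⟩ := exists_nsmul_eq_of_coprime hX hcop s
  refine ⟨m, fun g => ?_, ?_⟩
  · apply (nsmul_bijective_of_coprime hX hcop).1
    change Fintype.card Δ • (g • m) = Fintype.card Δ • m
    rw [smul_comm, hm, hsinv]
  · apply (nsmul_bijective_of_coprime hY hcop).1
    change Fintype.card Δ • f m = Fintype.card Δ • n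
    rw [← map_nsmul, hm, hfs]

end Invariants

end Summit.BirchSwinnertonDyer.Rank1Residual.GaloisImage

end
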